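import Summits.PneNP.PneNP.Theorems.ChebyshevTracialDesignKernelPileUp
import Summits.PneNP.PneNP.Theorems.ChebyshevTracialDesignWeightedSNT
import HarnessLib

/-!
# Cell pnp-psdrank, route `ChebyshevTracialDesign`, brick 68: the general-position budget lemma and the kernel pile-up, modulo
# Keevash–Lifshitz only — the (SNT-q) sub-weight hypothesis of eng's bricks DISCHARGED by brick 65

Eng g13's `…GeneralPositionBudget.rankOne_traceDensity_lt_of_generalPosition` (a rank-one cut side in general position is trace-sparse in every
dimension) and `…KernelPileUp.third_of_matchings_piled` (k heavy groups ⇒ the matchings hit by > k/4 of them carry > ⅓ of the matching weight)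
take the (SNT-q)-existence hypothesis WITH HEAVY SUB-WEIGHTS («every x' ≤ x of mass ≥ θ and every y' ≤ y carrying half of y have an active
tight pair») as an explicit input `hSNT`. Brick 65 (`…WeightedSNT.weightedSNT_subweights_of_globalLevelD`) proves exactly this shape, modulo
`GlobalLevelDInequality` [cite: KeevashLifshitz2023, Thm. 1.8], for a cut weight supported on the t-cuts and a matching weight whose edge-set
extension is `(PM_n, τ)`-homogeneous (Kupavskii–Zakharov) and dense. This file plugs one into the other:
* §1 `hSNT_trace_of_globalLevelD` — the sub-weight (SNT-q) in eng's TRACE currency (`y' ≤ tr Y_M`, `Σ tr Y ≤ 2 Σ y'`; divide by `r`).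
* §2 `rankOne_traceDensity_lt_of_globalLevelD` — for every τ ≥ 1: ∃ c₀ n₁, for even n ≥ n₁, odd balanced t, ε, ν ≥ exp(−c₀ dq n), every
  tight-orthogonal psd rectangle of dimension r ≥ 1 whose cut side is RANK-ONE, supported on the t-cuts and in GENERAL POSITION on its support,
  and whose matching trace weight tr(Y)/r is (PM_n, τ)-homogeneous of mass ≥ ν·#PM_n, has cut trace `Σ_U tr X_U / r < 2(ε·#t-cuts + 1)`:
  general position + density is impossible at every dimension (MEMO-14 §5(b), now a theorem mod KL).
* §3 `third_of_matchings_piled_of_globalLevelD` — the pile-up with the same discharge.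
[cite: KeevashLifshitz2023, Thm. 1.8] [cite: KupavskiiZakharov2022, §2] [cite: Rothvoss2017, §2 (PDF pp. 5–6)] [cite: BrietDadushPokutta2014, Thm. 6 (§3)]
Stature: support/instrument (kernel theorems, no defs). WHAT THIS IS NOT: no bound on the dense cell's VALUE, nothing on psd rank of
`P_PM(K_n)`, no P-vs-NP content. Supports stmt-PneNP-19878.
-/

set_option linter.dupNamespace false -- `Summit.PneNP.PneNP.…`: summit = sub-problem (D-0017)

noncomputable section

namespace Summit.PneNP.PneNP.Theorems.ChebyshevTracialDesignGeneralPositionKL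

open Finset Matrix Literature.Barriers.PneNP Literature.Combinatorics.Optimization
open Literature.Combinatorics.SetFamily
open Literature.Combinatorics.Additive.KeevashLifshitz (GlobalLevelDInequality)
open Summit.PneNP.PneNP.Theorems.ChebyshevTracialDesignGeneralPositionBudget (rankOne_traceDensity_lt_of_generalPosition)
open Summit.PneNP.PneNP.Theorems.ChebyshevTracialDesignKernelPileUp (third_of_matchings_piled)
open Summit.PneNP.PneNP.Theorems.ChebyshevTracialDesignWeightedSNT (weightedSNT_subweights_of_globalLevelD)
open Summit.PneNP.PneNP.Theorems.ChebyshevTracialDesignAPrioriBounds (trace_le_of_sub_posSemidef)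

variable {n : ℕ}

/-! ### §1 The sub-weight (SNT-q) in trace currency -/

/-- **(SNT-q) with heavy sub-weights, trace currency** (the `hSNT` of `…GeneralPositionBudget` / `…KernelPileUp`), from brick 65: given the
conclusion of `weightedSNT_subweights_of_globalLevelD` at `(τ, ε, ν)` for the instance `(n, t)`, a cut weight `x : OddSet n → [0,1]` vanishing
off the `t`-cuts and matching operators `0 ⪯ Y_M ⪯ I_r` (`r ≥ 1`) whose trace weight `tr(Y_M)/r` is `(PM_n, τ)`-homogeneous of mass `≥ ν·#PM_n`:
every `x' ≤ x` of mass `≥ ε·#t-cuts` and every `0 ≤ y' ≤ tr Y` with `Σ tr Y ≤ 2 Σ y'` have an active tight pair.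
[cite: KeevashLifshitz2023, Thm. 1.8] [cite: KupavskiiZakharov2022, §2] -/
theorem hSNT_trace_of_subweights {t r : ℕ} (hr : 0 < r) {τ ε ν : ℝ}
    (hS : ∀ (x : OddSet n → ℝ) (z : PMatch n → ℝ), (∀ U, 0 ≤ x U ∧ x U ≤ 1) → (∀ U, U.1.card ≠ t → x U = 0) →
      (∀ M, 0 ≤ z M ∧ z M ≤ 1) →
      IsRelHomogeneousW τ (perfectMatchings (univ : Finset (Fin n)))
        (fun M : Finset (Sym2 (Fin n)) => if hM : IsPMOn (univ : Finset (Fin n)) M then z ⟨M, hM⟩ else 0)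
        ((univ : Finset (PMatch n)).image Subtype.val) →
      ν * (Fintype.card (PMatch n) : ℝ) ≤ ∑ M, z M →
      ∀ x' : OddSet n → ℝ, (∀ U, 0 ≤ x' U ∧ x' U ≤ x U) →
        ε * ((univ.filter fun U : OddSet n => U.1.card = t).card : ℝ) ≤ ∑ U, x' U →
      ∀ z' : PMatch n → ℝ, (∀ M, 0 ≤ z' M ∧ z' M ≤ z M) → ∑ M, z M ≤ 2 * ∑ M, z' M →
        ∃ U M, cc U M = 1 ∧ 0 < x' U ∧ 0 < z' M)
    (x : OddSet n → ℝ) (hx : ∀ U, 0 ≤ x U ∧ x U ≤ 1) (hxt : ∀ U, U.1.card ≠ t → x U = 0)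
    (Y : PMatch n → Matrix (Fin r) (Fin r) ℝ) (hY : ∀ M, (Y M).PosSemidef ∧ (1 - Y M).PosSemidef)
    (hYhom : IsRelHomogeneousW τ (perfectMatchings (univ : Finset (Fin n)))
      (fun M : Finset (Sym2 (Fin n)) => if hM : IsPMOn (univ : Finset (Fin n)) M then (Y ⟨M, hM⟩).trace / r else 0)
      ((univ : Finset (PMatch n)).image Subtype.val))
    (hYmass : ν * (Fintype.card (PMatch n) : ℝ) ≤ ∑ M, (Y M).trace / r) :
    ∀ x' : OddSet n → ℝ, (∀ U, 0 ≤ x' U ∧ x' U ≤ x U) →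
      ε * ((univ.filter fun U : OddSet n => U.1.card = t).card : ℝ) ≤ ∑ U, x' U →
      ∀ y' : PMatch n → ℝ, (∀ M, 0 ≤ y' M ∧ y' M ≤ (Y M).trace) → ∑ M, (Y M).trace ≤ 2 * ∑ M, y' M →
        ∃ U M, cc U M = 1 ∧ 0 < x' U ∧ 0 < y' M := by
  intro x' hx' hx'm y' hy' hy'm
  have hr' : (0 : ℝ) < r := by exact_mod_cast hr
  have hz : ∀ M, 0 ≤ (Y M).trace / r ∧ (Y M).trace / r ≤ 1 := fun M =>
    ⟨div_nonneg (hY M).1.trace_nonneg hr'.le, (div_le_one hr').2 (trace_le_of_sub_posSemidef (hY M).2)⟩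
  have hz' : ∀ M, 0 ≤ y' M / r ∧ y' M / r ≤ (Y M).trace / r := fun M =>
    ⟨div_nonneg (hy' M).1 hr'.le, div_le_div_of_nonneg_right (hy' M).2 hr'.le⟩
  have hz'm : ∑ M, (Y M).trace / r ≤ 2 * ∑ M, y' M / r := by
    rw [← sum_div, ← sum_div, ← mul_div_assoc]
    exact div_le_div_of_nonneg_right hy'm hr'.le
  obtain ⟨U, M, hcc, hxU, hzM⟩ := hS x (fun M => (Y M).trace / r) hx hxt hz hYhom hYmass x' hx' hx'm (fun M => y' M / r) hz' hz'm
  exact ⟨U, M, hcc, hxU, (div_pos_iff_of_pos_right hr').1 hzM⟩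

/-! ### §2 The general-position budget lemma mod KL -/

/-- A rank-one operator with a unit direction vanishes only if its coefficient does. [folklore] -/
theorem coeff_eq_zero_of_rankOne_eq_zero {r : ℕ} {c : ℝ} {u : Fin r → ℝ} (hu : 0 < c → u ⬝ᵥ u = 1) (hc : 0 ≤ c)
    (h : c • vecMulVec u u = 0) : c = 0 := by
  by_contra hne
  have hcpos : 0 < c := lt_of_le_of_ne hc (Ne.symm hne)
  have hvv : vecMulVec u u = 0 := (smul_eq_zero.1 h).resolve_left hne
  have hu0 : u = 0 := by rcases (vecMulVec_eq_zero).1 hvv with h0 | h0 <;> exact h0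
  have := hu hcpos
  rw [hu0, zero_dotProduct] at this
  exact zero_ne_one this

/-- **GENERAL POSITION IS SPARSE, mod Keevash–Lifshitz.** For every `τ ≥ 1` there are `c₀ > 0`, `n₁` such that for even `n ≥ n₁`, odd `t`
with `n ≤ 5t`, `n ≤ 5(n−t)`, thresholds `ε, ν ≥ exp(−c₀·dq n)`, and every tight-orthogonal psd rectangle `(X, Y)` of dimension `r ≥ 1` with a
RANK-ONE cut side `X_U = x_U·u_Uu_Uᵀ` (`x_U ∈ [0,1]`, `u_U` a unit vector where `x_U > 0`) supported on the `t`-cuts whose active directions are in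
GENERAL POSITION (any `r` of them linearly independent), and a matching side whose trace weight `tr(Y_M)/r` is `(PM_n, τ)`-homogeneous of mass
`≥ ν·#PM_n`:  `Σ_U tr X_U / r < 2(ε·#t-cuts + 1)` — the cut side has trace density `< 2(ε + 1/#t-cuts)`, at EVERY dimension `r`.
(Eng's `rankOne_traceDensity_lt_of_generalPosition` + brick 65.) [cite: KeevashLifshitz2023, Thm. 1.8] [cite: Rothvoss2017, §2 (PDF pp. 5–6)]
[cite: BrietDadushPokutta2014, Thm. 6 (§3)] -/
theorem rankOne_traceDensity_lt_of_globalLevelD (hKL : GlobalLevelDInequality) {τ : ℝ} (hτ : 1 ≤ τ) :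
    ∃ c₀ : ℝ, 0 < c₀ ∧ ∃ n₁ : ℕ, ∀ (n t : ℕ), n₁ ≤ n → Even n → Odd t → n ≤ 5 * t → n ≤ 5 * (n - t) →
      ∀ (ε ν : ℝ), Real.exp (-(c₀ * dq n)) ≤ ε → Real.exp (-(c₀ * dq n)) ≤ ν →
      ∀ (r : ℕ), 0 < r → ∀ (X : OddSet n → Matrix (Fin r) (Fin r) ℝ) (Y : PMatch n → Matrix (Fin r) (Fin r) ℝ), IsPsdRect X Y →
      ∀ (x : OddSet n → ℝ) (u : OddSet n → Fin r → ℝ), (∀ U, 0 ≤ x U ∧ x U ≤ 1) →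
      (∀ U, X U = x U • vecMulVec (u U) (u U)) → (∀ U, 0 < x U → u U ⬝ᵥ u U = 1) → (∀ U, U.1.card ≠ t → X U = 0) →
      (∀ T : Finset (OddSet n), (∀ U ∈ T, 0 < x U) → T.card = r → LinearIndependent ℝ (fun U : T => u U.1)) →
      IsRelHomogeneousW τ (perfectMatchings (univ : Finset (Fin n)))
        (fun M : Finset (Sym2 (Fin n)) => if hM : IsPMOn (univ : Finset (Fin n)) M then (Y ⟨M, hM⟩).trace / r else 0)
        ((univ : Finset (PMatch n)).image Subtype.val) →
      ν * (Fintype.card (PMatch n) : ℝ) ≤ ∑ M, (Y M).trace / r →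
      (∑ U, (X U).trace) / r < 2 * (ε * ((univ.filter fun U : OddSet n => U.1.card = t).card : ℝ) + 1) := by
  obtain ⟨c₀, hc₀, n₁, hS⟩ := weightedSNT_subweights_of_globalLevelD hKL hτ
  refine ⟨c₀, hc₀, n₁, ?_⟩
  intro n t hn hev hto h5 h5' ε ν hε hν r hr X Y hXY x u hx hX hu hXt hgp hYhom hYmass
  have hε0 : 0 ≤ ε := (Real.exp_pos _).le.trans hε
  have hxt : ∀ U, U.1.card ≠ t → x U = 0 := fun U hU =>
    coeff_eq_zero_of_rankOne_eq_zero (hu U) (hx U).1 (by rw [← hX U]; exact hXt U hU)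
  have hθ : (0 : ℝ) ≤ ε * ((univ.filter fun U : OddSet n => U.1.card = t).card : ℝ) := by positivity
  exact rankOne_traceDensity_lt_of_generalPosition hr hXY x u hx hX hu hgp hθ
    (hSNT_trace_of_subweights hr (hS n t hn hev hto h5 h5' ε ν hε hν) x hx hxt Y hXY.2.1 hYhom hYmass)

/-! ### §3 The kernel pile-up mod KL -/

/-- **KERNEL PILE-UP, mod Keevash–Lifshitz** (eng's `third_of_matchings_piled` + brick 65, with the matching weight `y = tr Y/r`): for every
`τ ≥ 1` there are `c₀ > 0`, `n₁` such that for even `n ≥ n₁`, odd balanced `t`, `ε, ν ≥ exp(−c₀·dq n)`, a cut weight `x : OddSet n → [0,1]`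
vanishing off the `t`-cuts, matching operators `0 ⪯ Y_M ⪯ I_r` (`r ≥ 1`) with `(PM_n, τ)`-homogeneous trace weight of mass `≥ ν·#PM_n`, and
`k ≥ 1` groups of cuts each of `x`-mass `≥ ε·#t-cuts`: the matchings having an active tight partner in MORE THAN `k/4` of the groups carry more
than a third of `Σ_M tr(Y_M)/r`. [cite: KeevashLifshitz2023, Thm. 1.8] [cite: Rothvoss2017, §2 (PDF pp. 5–6)] -/
theorem third_of_matchings_piled_of_globalLevelD (hKL : GlobalLevelDInequality) {τ : ℝ} (hτ : 1 ≤ τ) :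
    ∃ c₀ : ℝ, 0 < c₀ ∧ ∃ n₁ : ℕ, ∀ (n t : ℕ), n₁ ≤ n → Even n → Odd t → n ≤ 5 * t → n ≤ 5 * (n - t) →
      ∀ (ε ν : ℝ), Real.exp (-(c₀ * dq n)) ≤ ε → Real.exp (-(c₀ * dq n)) ≤ ν →
      ∀ (r : ℕ), 0 < r → ∀ (x : OddSet n → ℝ), (∀ U, 0 ≤ x U ∧ x U ≤ 1) → (∀ U, U.1.card ≠ t → x U = 0) →
      ∀ (Y : PMatch n → Matrix (Fin r) (Fin r) ℝ), (∀ M, (Y M).PosSemidef ∧ (1 - Y M).PosSemidef) →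
      IsRelHomogeneousW τ (perfectMatchings (univ : Finset (Fin n)))
        (fun M : Finset (Sym2 (Fin n)) => if hM : IsPMOn (univ : Finset (Fin n)) M then (Y ⟨M, hM⟩).trace / r else 0)
        ((univ : Finset (PMatch n)).image Subtype.val) →
      ν * (Fintype.card (PMatch n) : ℝ) ≤ ∑ M, (Y M).trace / r →
      ∀ (k : ℕ), 0 < k → ∀ (G : Fin k → Finset (OddSet n)),
      (∀ j, ε * ((univ.filter fun U : OddSet n => U.1.card = t).card : ℝ) ≤ ∑ U ∈ G j, x U) →
      ∑ M, (Y M).trace < 3 * ∑ M ∈ univ.filter (fun M : PMatch n =>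
        k < 4 * (univ.filter fun j : Fin k => ∃ U ∈ G j, 0 < x U ∧ cc U M = 1).card), (Y M).trace := by
  obtain ⟨c₀, hc₀, n₁, hS⟩ := weightedSNT_subweights_of_globalLevelD hKL hτ
  refine ⟨c₀, hc₀, n₁, ?_⟩
  intro n t hn hev hto h5 h5' ε ν hε hν r hr x hx hxt Y hY hYhom hYmass k hk G hG
  exact third_of_matchings_piled x (fun U => (hx U).1) (fun M => (Y M).trace) (fun M => (hY M).1.trace_nonneg)
    (hSNT_trace_of_subweights hr (hS n t hn hev hto h5 h5' ε ν hε hν) x hx hxt Y hY hYhom hYmass) hk G hG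

end Summit.PneNP.PneNP.Theorems.ChebyshevTracialDesignGeneralPositionKL
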